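import Summits.QuantumFields.BalabanUV.T4Continuum.Support.ShellMeasureScalingLocal
import Literature.MathematicalPhysics.QuantumFieldTheory.Balaban1983to89.T4ShellMeasureDet
import Literature.MathematicalPhysics.QuantumFieldTheory.Balaban1983to89.T4CubeChartExp

/-!
# `T4Continuum.ShellMeasureScalingSU2` — the scaling engine over the REALIZED configuration space for `G = SU(2)`:
# the exponential-chart Haar Jacobian and the cube window ride at cost zero, (CH) holds by name, and the realized
# headline carries no chart-side binder
# (cell `pub-balaban`, sub-cell `t4`, spine estimate NE7c (node U5b), lineage t4-ne7c-p1 = PROVER seat P1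
# «shell-measure route», generation 21; tree target `Summits/QuantumFields/BalabanUV/T4Continuum/Support/`;
# ADDITIVE — imports `ShellMeasureScalingLocal`, `T4ShellMeasureDet`, `T4CubeChartExp` and modifies nothing)

HONEST FRAMING.  Finite four-torus programme, rung (B)+1 only — NOT infinite volume, NOT a mass gap, NOT the Clay
problem, NOT summit progress; (B), `BetaPertHyp`, (B^μ) are not mentioned because nothing here consumes them.  The
cell wall of NE7c — (M1) `T4ShellMeasure.SlotAntiConcentration` FOR BAŁABAN'S INDUCTIVELY DEFINED EFFECTIVE MEASURES —
is NOT PRINTED in [Balaban 1983–89] (GAPS G-ne7cp1-1), asserted by nobody, and NOT moved by this file.  Two SHARES of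
the smooth member's located inputs (GAPS G-ne7cp1-17, -19, -21) are discharged here for the production-type group
`G = SU(2)` (print's B12 Thm 2 case) by composing tree theorems BY NAME.  Every declaration is [folklore] kernel
mathematics, 0 sorry, 0 citations (nothing printed is transcribed).

THE POINTS.
* §1 THE CHART-SIDE FACTORS DO NOT DECREASE TOWARDS THE CENTRE.  The one-bond exponential Haar weight
  `(2π²)⁻¹ sinc²‖x‖` of `T4HaarSU2ExpChart` is non-decreasing towards the centre on the injectivity ball `‖x‖ ≤ π`
  (`sinc` is non-increasing and non-negative on `[0, π]`: secant slopes of the concave `sin`); hence so is the block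
  Jacobian `e^{−jac_e} = ∏_b (2π²)⁻¹sinc²|x_b|` of `T4CubeChartExp` on the cube `[-S,S]ⁿ` (`3S² < π²`: every bond block
  sits in the ball), and the cube window is STAR-SHAPED; together: `chartWeight_le_smul` for the chart-side weight
  `1_{[-S,S]ⁿ}·e^{−jac_e}` along every contraction `x ↦ e^{−a}x`, `a ≥ 0`.  CONSEQUENCE for the ledger: the located
  binder (DC-loc) = «forward log-Lipschitz rate of ρ_sf × chart Jacobian» (G-ne7cp1-17) loses its «× chart Jacobian»
  by `ShellMeasureScalingLocal.slotAntiConcentration_of_coreMap_mul`: for `G = SU(2)` (S-ii) concerns the block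
  weight ALONE.
* §2 (CH) FOR `SU(2)` BY NAME.  `T4ShellMeasureDet` left the chart identity (CH) a hypothesis (`hchart`) and recorded
  a scratch compatibility check only (gen 12).  `chart_su2` IS that hypothesis for the exponential cube chart, obtained
  from `T4CubeChartExp.cubeChart_specialUnitaryTwo_exp` (`blockLaw = fibreBase` by `rfl`, `withDensity_indicator`);
  `chartLaw_univ_eq` transports total mass through it (the finiteness proviso).  The realized headline
  `slotAntiConcentration_realized_su2_of_coreMap` then carries NO chart binder, NO Jacobian share and NO window share:
  per frozen exterior `V` its analytic hypotheses are the core map `hcore` (S-i) and the ray-weight loss `hden` (S-ii)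
  of the block weight `R V` read in the chart — on the cube, on the support, below the threshold only — plus the window
  factorisation `hFw` of the realized density (to be asked after the tree gauge of `ShellMeasureScalingLocal` §3) and
  a per-section finiteness; the conclusion is (M1) for `(fieldMeasure P j SU2).withDensity F` with any `D`,
  `(n + B_f)·a ≤ D·ρ`, `n = 3·#Λ` the chart dimension.

WHAT THIS DOES NOT DO.  No instance of (S-i)/(S-ii) for Bałaban's localized minimisers / block weights is constructed;
the window factorisation `hFw`, the chart centres `c V` and the per-section finiteness are hypotheses; (Det), (FI-sat),
(LR), (MR), (W1), the (F∞)-rate keep their status; `SU(2)` only.  NE7c NOT proved.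
-/

namespace Summit.QuantumFields.BalabanUV.T4Continuum.ShellMeasureScalingSU2

open MeasureTheory Set Function
open scoped ENNReal
open Literature.MathematicalPhysics.QuantumFieldTheory.Balaban1983to89
open T4ShellMeasure (SlotAntiConcentration)
open ShellMeasureScalingLocal (slotAntiConcentration_of_coreMap_mul)

/-! ## §1 The SU(2) exponential cube chart: Jacobian and window do not decrease towards the centre -/

section Jacobian

open T4CubePoincare (cube mem_cube_iff measurableSet_cube')
open T4HaarSU2ExpChart (expWeight)
open T4CubeChartGnomonic (regroup regroup_apply_eq)
open T4CubeChartExp (toE expCubeWeight expCubeWeight_nonneg expJac exp_neg_expJac regroup_mem_cube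
  toE_mem_ball_of_mem_cube)

/-- `sinc` is non-increasing and non-negative on `[0, π]` (secant slopes of the concave `sin` through `0`):
`0 ≤ r ≤ r' ≤ π ⇒ 0 ≤ sinc r' ≤ sinc r`. [folklore] -/
theorem sinc_le_sinc_of_le_of_le_pi {r r' : ℝ} (hr : 0 ≤ r) (hrr' : r ≤ r') (hr' : r' ≤ Real.pi) :
    0 ≤ Real.sinc r' ∧ Real.sinc r' ≤ Real.sinc r := by
  have hsinc_nonneg : ∀ t, 0 ≤ t → t ≤ Real.pi → 0 ≤ Real.sinc t := by
    intro t ht0 htπ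
    rcases ht0.eq_or_lt with h | h
    · rw [← h, Real.sinc_zero]; exact zero_le_one
    · rw [Real.sinc_of_ne_zero h.ne']
      exact div_nonneg (Real.sin_nonneg_of_nonneg_of_le_pi ht0 htπ) ht0
  refine ⟨hsinc_nonneg r' (hr.trans hrr') hr', ?_⟩
  rcases hr.eq_or_lt with h0 | hr0
  · rw [← h0, Real.sinc_zero]; exact Real.sinc_le_one r'
  have hr'0 : 0 < r' := hr0.trans_le hrr'
  have hconv : ConvexOn ℝ (Icc 0 Real.pi) (fun t => -Real.sin t) := strictConcaveOn_sin_Icc.concaveOn.neg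
  have h := hconv.secant_mono (a := 0) (x := r) (y := r') ⟨le_rfl, Real.pi_pos.le⟩
    ⟨hr, hrr'.trans hr'⟩ ⟨hr'0.le, hr'⟩ hr0.ne' hr'0.ne' hrr'
  simp only [Real.sin_zero, neg_zero, sub_zero] at h
  rw [Real.sinc_of_ne_zero hr0.ne', Real.sinc_of_ne_zero hr'0.ne']
  rw [neg_div, neg_div, neg_le_neg_iff] at h
  exact h

/-- **THE ONE-BOND EXPONENTIAL HAAR WEIGHT `(2π²)⁻¹ sinc²‖x‖` DOES NOT DECREASE TOWARDS THE CENTRE** on the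
injectivity ball `‖x‖ ≤ π`: `expWeight x ≤ expWeight (c • x)` for `0 ≤ c ≤ 1`. [folklore] -/
theorem expWeight_le_expWeight_smul {x : EuclideanSpace ℝ (Fin 3)} (hx : ‖x‖ ≤ Real.pi) {c : ℝ} (hc0 : 0 ≤ c)
    (hc1 : c ≤ 1) : expWeight x ≤ expWeight (c • x) := by
  unfold expWeight
  rw [norm_smul, Real.norm_eq_abs, abs_of_nonneg hc0]
  have hcx : c * ‖x‖ ≤ ‖x‖ := by nlinarith [norm_nonneg x]
  obtain ⟨h0, hle⟩ := sinc_le_sinc_of_le_of_le_pi (mul_nonneg hc0 (norm_nonneg x)) hcx hx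
  have h2 : Real.sinc ‖x‖ ^ 2 ≤ Real.sinc (c * ‖x‖) ^ 2 := pow_le_pow_left₀ h0 hle 2
  exact mul_le_mul_of_nonneg_left h2 (by positivity)

/-- the same in cube coordinates: on `[-S,S]³` with `3S² < π²`, `w(v) ≤ w(c·v)` for `0 ≤ c ≤ 1`. [folklore] -/
theorem expCubeWeight_le_smul {S : ℝ} (hSπ : 3 * S ^ 2 < Real.pi ^ 2) {v : Fin 3 → ℝ} (hv : v ∈ cube 3 S)
    {c : ℝ} (hc0 : 0 ≤ c) (hc1 : c ≤ 1) : expCubeWeight v ≤ expCubeWeight (c • v) := by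
  unfold expCubeWeight
  have hx : ‖toE v‖ ≤ Real.pi := le_of_lt (mem_ball_zero_iff.1 (toE_mem_ball_of_mem_cube hSπ hv))
  have he : toE (c • v) = c • toE v := WithLp.toLp_smul _ _ _
  rw [he]
  exact expWeight_le_expWeight_smul hx hc0 hc1

/-- the cube window `[-S,S]ⁿ` is STAR-SHAPED about the centre. [folklore] -/
theorem smul_mem_cube {n : ℕ} {S : ℝ} {x : Fin n → ℝ} (hx : x ∈ cube n S) {c : ℝ} (hc0 : 0 ≤ c) (hc1 : c ≤ 1) :
    c • x ∈ cube n S := by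
  rw [mem_cube_iff] at hx ⊢
  intro i
  rw [Pi.smul_apply, smul_eq_mul, abs_mul, abs_of_nonneg hc0]
  calc c * |x i| ≤ 1 * |x i| := mul_le_mul_of_nonneg_right hc1 (abs_nonneg _)
    _ ≤ S := by rw [one_mul]; exact hx i

variable {P : Params} {j : ℕ} {s : Finset (PBond P j)} {n : ℕ}

/-- **THE BLOCK JACOBIAN `e^{−jac_e} = ∏_b (2π²)⁻¹sinc²|x_b|` OF THE EXPONENTIAL FIBRE CHART DOES NOT DECREASE
TOWARDS THE CENTRE** on the cube `[-S,S]ⁿ`, `3S² < π²`. [folklore] -/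
theorem exp_neg_expJac_le_smul (e : ↥s × Fin 3 ≃ Fin n) {S : ℝ} (hSπ : 3 * S ^ 2 < Real.pi ^ 2)
    {x : Fin n → ℝ} (hx : x ∈ cube n S) {c : ℝ} (hc0 : 0 ≤ c) (hc1 : c ≤ 1) :
    Real.exp (-expJac s e x) ≤ Real.exp (-expJac s e (c • x)) := by
  rw [exp_neg_expJac e hSπ hx, exp_neg_expJac e hSπ (smul_mem_cube hx hc0 hc1)]
  refine Finset.prod_le_prod (fun b _ => expCubeWeight_nonneg _) fun b _ => ?_
  have hb : regroup s e (c • x) b = c • regroup s e x b := by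
    rw [regroup_apply_eq, regroup_apply_eq]
    funext i
    rw [Pi.smul_apply, Pi.smul_apply, smul_eq_mul]
  rw [hb]
  exact expCubeWeight_le_smul hSπ (regroup_mem_cube e hx b) hc0 hc1

/-- the chart-side weight `1_{[-S,S]ⁿ}·e^{−jac_e}` of the tree's `SU(2)` exponential cube chart is measurable.
[folklore] -/
theorem measurable_chartWeight (e : ↥s × Fin 3 ≃ Fin n) (S : ℝ) :
    Measurable ((cube n S).indicator fun x => ENNReal.ofReal (Real.exp (-expJac s e x))) :=
  (ENNReal.measurable_ofReal.comp (Real.measurable_exp.comp (T4CubeChartExp.measurable_expJac e).neg)).indicator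
    (measurableSet_cube' n S)

/-- a point where the chart weight is non-zero lies in the cube. [folklore] -/
theorem mem_cube_of_chartWeight_ne_zero {e : ↥s × Fin 3 ≃ Fin n} {S : ℝ} {x : Fin n → ℝ}
    (h : (cube n S).indicator (fun x => ENNReal.ofReal (Real.exp (-expJac s e x))) x ≠ 0) : x ∈ cube n S := by
  by_contra hx
  exact h (indicator_of_notMem hx _)

/-- **THE CHART WEIGHT (window × Jacobian) DOES NOT DECREASE TOWARDS THE CENTRE along the contraction
`x ↦ e^{−a}x`, `a ≥ 0`** — so it rides free in (S-ii) (`ShellMeasureScalingLocal` §2). [folklore] -/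
theorem chartWeight_le_smul (e : ↥s × Fin 3 ≃ Fin n) {S : ℝ} (hSπ : 3 * S ^ 2 < Real.pi ^ 2) {a : ℝ}
    (ha : 0 ≤ a) (x : Fin n → ℝ) :
    (cube n S).indicator (fun x => ENNReal.ofReal (Real.exp (-expJac s e x))) x ≤
      (cube n S).indicator (fun x => ENNReal.ofReal (Real.exp (-expJac s e x))) (Real.exp (-a) • x) := by
  have hc0 : 0 ≤ Real.exp (-a) := (Real.exp_pos _).le
  have hc1 : Real.exp (-a) ≤ 1 := by rw [Real.exp_le_one_iff]; linarith
  by_cases hx : x ∈ cube n S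
  · rw [indicator_of_mem hx, indicator_of_mem (smul_mem_cube hx hc0 hc1)]
    exact ENNReal.ofReal_le_ofReal (exp_neg_expJac_le_smul e hSπ hx hc0 hc1)
  · rw [indicator_of_notMem hx]
    exact bot_le

end Jacobian

/-! ## §2 (CH) for `SU(2)` by name, and the realized engine with no chart-side binder -/

section Realized

open T4CubePoincare (cube measurableSet_cube')
open T4CubeChartGnomonic (SU2)
open T4CubeChartExp (expJac expWindowDensity measurable_expWindowDensity expFibreChart continuous_expFibreChart
  cubeChart_specialUnitaryTwo_exp)
open T4ShellMeasureDet (blockLaw blockLaw_eq_pi withDensity_eq_map_chart slotAntiConcentration_of_chart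
  slotAntiConcentration_realized_of_sections measurable_section)

variable {P : Params} {j : ℕ} [DecidableEq (PBond P j)]

/-- **(CH) FOR `SU(2)` — THE CHART IDENTITY, BY NAME.**  The block law (product Haar on the bonds of `Λ`) windowed by
the product exponential window of half-side `S` about `u₀` IS the image of Lebesgue measure on `ℝⁿ` (`n` = the
enumerated `3·#Λ` coordinates) tilted by the chart weight `1_{[-S,S]ⁿ}·e^{−jac_e}` under the exponential fibre chart —
`T4CubeChartExp.cubeChart_specialUnitaryTwo_exp` unfolded (`blockLaw Λ = fibreBase Λ` by `rfl`), in the orientation of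
`T4ShellMeasureDet.slotAntiConcentration_of_chart`. [folklore] -/
theorem chart_su2 (Λ : Finset (PBond P j)) (u₀ : GaugeField P j SU2) {n : ℕ} (e : ↥Λ × Fin 3 ≃ Fin n) {S : ℝ}
    (hS : 0 < S) (hSπ : 3 * S ^ 2 < Real.pi ^ 2) :
    (blockLaw Λ).withDensity (fun y => ENNReal.ofReal (expWindowDensity Λ u₀ S (updateFinset u₀ Λ y))) =
      ((volume : Measure (Fin n → ℝ)).withDensity
        ((cube n S).indicator fun x => ENNReal.ofReal (Real.exp (-expJac Λ e x)))).map (expFibreChart Λ u₀ e) := by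
  have h := (cubeChart_specialUnitaryTwo_exp Λ u₀ e hS hSπ).map_eq
  rw [blockLaw_eq_pi, withDensity_indicator (measurableSet_cube' n S)]
  exact h

/-- the total mass of the chart-side section law equals the total mass of the block section of the realized density
(transport through (CH); used for the finiteness proviso). [folklore] -/
theorem chartLaw_univ_eq (Λ : Finset (PBond P j)) (u₀ : GaugeField P j SU2) {n : ℕ} (e : ↥Λ × Fin 3 ≃ Fin n)
    {S : ℝ} (hS : 0 < S) (hSπ : 3 * S ^ 2 < Real.pi ^ 2) {R : (↥Λ → SU2) → ℝ≥0∞} (hR : Measurable R) :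
    ((volume : Measure (Fin n → ℝ)).withDensity fun x =>
      (cube n S).indicator (fun x => ENNReal.ofReal (Real.exp (-expJac Λ e x))) x * R (expFibreChart Λ u₀ e x))
        univ =
      ((blockLaw Λ).withDensity fun y =>
        ENNReal.ofReal (expWindowDensity Λ u₀ S (updateFinset u₀ Λ y)) * R y) univ := by
  have hκ : Measurable (expFibreChart Λ u₀ e) := (continuous_expFibreChart e).measurable
  have hw : Measurable fun y : ↥Λ → SU2 => ENNReal.ofReal (expWindowDensity Λ u₀ S (updateFinset u₀ Λ y)) :=
    ENNReal.measurable_ofReal.comp ((measurable_expWindowDensity Λ u₀ S).comp measurable_updateFinset)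
  rw [withDensity_eq_map_chart (blockLaw Λ) volume hκ (measurable_chartWeight e S) hw (chart_su2 Λ u₀ e hS hSπ) hR,
    Measure.map_apply hκ MeasurableSet.univ, preimage_univ]

/-- **THE REALIZED ENGINE FOR `G = SU(2)`, NO CHART-SIDE BINDER.**  Data: the bonds `Λ` of the slot's block with an
enumeration `e` of the `n = 3·#Λ` chart coordinates; a window half-side `S` (`0 < S`, `3S² < π²`); for every exterior
`V` a chart centre `c V` and a measurable block weight `R V`; the realized density `F` with the WINDOW FACTORISATION
`F(V[Λ := y]) = χ_{Λ,cV,S}(y)·R V y` (hypothesis `hFw`); per-section finiteness; the tested variable `u`; numbers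
`θ, ρ ≥ 0`, a depth `a ≥ 0`, `B_f`, and `D` with `(n + B_f)·a ≤ D·ρ`.  ANALYTIC HYPOTHESES, per `V`, for chart points
`x` in the cube, on the support of `R V` and below the threshold ONLY: (S-i) `hcore` — the contraction `e^{−a}x` is
read below `θ(1−ρ)`; (S-ii) `hden` — `R V(κ x) ≤ e^{B_f a}·R V(κ(e^{−a}x))`, the block weight ALONE (the Jacobian
`e^{−jac_e}` and the window ride free by §1, the chart identity is `chart_su2`).  CONCLUSION: (M1)
`SlotAntiConcentration ((fieldMeasure P j SU2).withDensity F) u θ ρ D`. [folklore] -/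
theorem slotAntiConcentration_realized_su2_of_coreMap (Λ : Finset (PBond P j)) {n : ℕ} (e : ↥Λ × Fin 3 ≃ Fin n)
    {S : ℝ} (hS : 0 < S) (hSπ : 3 * S ^ 2 < Real.pi ^ 2) (c : GaugeField P j SU2 → GaugeField P j SU2)
    {R : GaugeField P j SU2 → (↥Λ → SU2) → ℝ≥0∞} (hR : ∀ V, Measurable (R V))
    {F : GaugeField P j SU2 → ℝ≥0∞} (hF : Measurable F)
    (hFw : ∀ V y, F (updateFinset V Λ y) =
      ENNReal.ofReal (expWindowDensity Λ (c V) S (updateFinset (c V) Λ y)) * R V y)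
    (hfin : ∀ V, ((blockLaw Λ).withDensity fun y => F (updateFinset V Λ y)) univ ≠ ∞)
    {u : GaugeField P j SU2 → ℝ} (hu : Measurable u) {θ ρ a Bf D : ℝ} (hθ : 0 ≤ θ) (hρ : 0 ≤ ρ) (ha : 0 ≤ a)
    (haD : ((n : ℝ) + Bf) * a ≤ D * ρ)
    (hcore : ∀ V x, x ∈ cube n S → R V (expFibreChart Λ (c V) e x) ≠ 0 →
      u (updateFinset V Λ (expFibreChart Λ (c V) e x)) < θ →
      u (updateFinset V Λ (expFibreChart Λ (c V) e (Real.exp (-a) • x))) < θ * (1 - ρ))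
    (hden : ∀ V x, x ∈ cube n S → R V (expFibreChart Λ (c V) e x) ≠ 0 →
      u (updateFinset V Λ (expFibreChart Λ (c V) e x)) < θ →
      R V (expFibreChart Λ (c V) e x) ≤
        ENNReal.ofReal (Real.exp (Bf * a)) * R V (expFibreChart Λ (c V) e (Real.exp (-a) • x))) :
    SlotAntiConcentration ((fieldMeasure P j SU2).withDensity F) u θ ρ D := by
  refine slotAntiConcentration_realized_of_sections Λ hF hu fun V => ?_
  have hκ : Measurable (expFibreChart Λ (c V) e) := (continuous_expFibreChart e).measurable
  have hw : Measurable fun y : ↥Λ → SU2 =>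
      ENNReal.ofReal (expWindowDensity Λ (c V) S (updateFinset (c V) Λ y)) :=
    ENNReal.measurable_ofReal.comp ((measurable_expWindowDensity Λ (c V) S).comp measurable_updateFinset)
  have hsecF : (fun y => F (updateFinset V Λ y)) =
      fun y => ENNReal.ofReal (expWindowDensity Λ (c V) S (updateFinset (c V) Λ y)) * R V y := funext (hFw V)
  have huV : Measurable fun y => u (updateFinset V Λ y) := measurable_section Λ hu V
  rw [hsecF]
  refine slotAntiConcentration_of_chart (blockLaw Λ) volume hκ (measurable_chartWeight e S) hw
    (chart_su2 Λ (c V) e hS hSπ) (hR V) huV ?_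
  -- (M1) in the chart: the engine in H-form with the chart weight riding free
  have hfin' : ((volume : Measure (Fin n → ℝ)).withDensity fun x =>
      (cube n S).indicator (fun x => ENNReal.ofReal (Real.exp (-expJac Λ e x))) x *
        R V (expFibreChart Λ (c V) e x)) {x | ((fun y => u (updateFinset V Λ y)) ∘
        expFibreChart Λ (c V) e) x < θ} ≠ ∞ := by
    refine ne_top_of_le_ne_top ?_ (measure_mono (subset_univ _))
    rw [chartLaw_univ_eq Λ (c V) e hS hSπ (hR V), ← hsecF]
    exact hfin V
  refine slotAntiConcentration_of_coreMap_mul volume (huV.comp hκ) (Bf := Bf) (D := D) hθ hρ hfin'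
    (fun x => chartWeight_le_smul e hSπ ha x) (fun x hx hJ hg => ?_) (fun x hx hJ hg => ?_) ?_
  · exact hcore V x (mem_cube_of_chartWeight_ne_zero hJ) hg hx
  · exact hden V x (mem_cube_of_chartWeight_ne_zero hJ) hg hx
  · simpa only [Module.finrank_fintype_fun_eq_card, Fintype.card_fin] using haD

end Realized

end Summit.QuantumFields.BalabanUV.T4Continuum.ShellMeasureScalingSU2
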